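import Mathlib.Analysis.Complex.Basic
import Mathlib.Analysis.Normed.Group.InfiniteSum
import Mathlib.Analysis.Real.Sqrt
import Mathlib.Topology.Algebra.InfiniteSum.Real
import Mathlib.Tactic.Linarith
import Mathlib.Tactic.Positivity
import Mathlib.Tactic.Ring
import HarnessLib

/-!
# Thermal versus time-periodic torus numerators: the twisted double-trace return estimate
(stub `stub_numerator_comparison` of line `twisted_trace_transfer` for crux
`QuarksAsStableAction.StableActionBridge`, item stmt-QuantumFields-9737, §8 E3)

In step E3 of the line, `λᵢ ≥ 0` are the eigenvalues of lattice QCD's positive transfer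
operator, `σᵢ = ±1` the fermion parities of a parity-adapted eigenbasis and `i₀` the (even)
vacuum index; `Xᵢⱼ = ⟪bᵢ, 𝒳 bⱼ⟫`, `X'ⱼᵢ = ⟪bⱼ, 𝒳' bᵢ⟫` are the matrix entries of two bounded
insertions, whose rows (resp. columns) are square-summable with `ℓ²`-norms at most `BX`
(resp. `BX'`) (Bessel).  The THERMAL numerator is the double spectral sum
`Sth = Σ_{(i,j)} λⱼ^α λᵢ^β Xᵢⱼ X'ⱼᵢ` (`Tr(𝒳 𝕋^α 𝒳' 𝕋^β)`) and the TWISTED one carries the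
parities, `Stw = Σ_{(i,j)} λⱼ^α λᵢ^β σᵢ Xᵢⱼ X'ⱼᵢ`.  This abstract lemma is the numerator analogue
of `stub_denominator_comparison`:

  `‖Stw − Sth‖ ≤ 2 ‖𝒳‖ ‖𝒳'‖ λ_{i₀}^α (Σᵢ λᵢ^β − λ_{i₀}^β)`.

Proof.  `Stw − Sth = Σ_p (σ_{p.1} − 1) λ_{p.2}^α λ_{p.1}^β X X'` (`HasSum.sub`); the summand
vanishes when `p.1 = i₀` (`σ_{i₀} = 1`) and otherwise has norm at most
`2 λ_{i₀}^α λ_{p.1}^β ‖X_{p.1 p.2}‖ ‖X'_{p.2 p.1}‖` (`|σ − 1| ≤ 2`, `λ_{p.2} ≤ λ_{i₀}`).  The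
dominating non-negative family `g p := c_{p.1} ‖X_{p.1 p.2}‖ ‖X'_{p.2 p.1}‖` with
`c_i := 2 λ_{i₀}^α · (0 if i = i₀ else λᵢ^β)` is summable over `ι × ι` with sum at most
`2 λ_{i₀}^α (T − λ_{i₀}^β) · BX BX'`: each fibre sums to at most `c_i BX BX'` by the
Cauchy–Schwarz inequality on finite partial sums (`Real.sum_mul_le_sqrt_mul_sqrt`,
`summable_of_sum_le`, `Real.tsum_le_of_sum_le`), and the fibre sums are dominated by the
summable family `c_i BX BX'` (`Σ_{i ≠ i₀} λᵢ^β = T − λ_{i₀}^β`, `hasSum_ite_sub_hasSum`), so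
`summable_prod_of_nonneg` and `HasSum.prod_fiberwise` apply; conclude with
`HasSum.norm_le_of_bounded`.  Mathlib only. [folklore]
-/

namespace Summit.QuantumFields.QCD.Cruxes.StableActionBridge.TwistedTraceTransfer

namespace StubNumeratorComparison

/-- **Cauchy–Schwarz in `ℓ²` through partial sums.**  If `a, b ≥ 0` are square-summable with
`Σ a² ≤ A²`, `Σ b² ≤ B²` (`A, B ≥ 0`), then `Σ a b` converges and is at most `A B`. [folklore] -/
theorem summable_mul_and_tsum_le {ι : Type*} {a b : ι → ℝ} {A B : ℝ}
    (ha0 : ∀ j, 0 ≤ a j) (hb0 : ∀ j, 0 ≤ b j) (hA : 0 ≤ A) (hB : 0 ≤ B)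
    (ha : Summable fun j => a j ^ 2) (ha' : ∑' j, a j ^ 2 ≤ A ^ 2)
    (hb : Summable fun j => b j ^ 2) (hb' : ∑' j, b j ^ 2 ≤ B ^ 2) :
    (Summable fun j => a j * b j) ∧ ∑' j, a j * b j ≤ A * B := by
  have key : ∀ u : Finset ι, ∑ j ∈ u, a j * b j ≤ A * B := by
    intro u
    have hua : ∑ j ∈ u, a j ^ 2 ≤ A ^ 2 := (ha.sum_le_tsum u fun j _ => sq_nonneg (a j)).trans ha'
    have hub : ∑ j ∈ u, b j ^ 2 ≤ B ^ 2 := (hb.sum_le_tsum u fun j _ => sq_nonneg (b j)).trans hb'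
    calc ∑ j ∈ u, a j * b j ≤ √(∑ j ∈ u, a j ^ 2) * √(∑ j ∈ u, b j ^ 2) :=
          Real.sum_mul_le_sqrt_mul_sqrt u a b
      _ ≤ √(A ^ 2) * √(B ^ 2) :=
          mul_le_mul (Real.sqrt_le_sqrt hua) (Real.sqrt_le_sqrt hub) (Real.sqrt_nonneg _)
            (Real.sqrt_nonneg _)
      _ = A * B := by rw [Real.sqrt_sq hA, Real.sqrt_sq hB]
  have hnn : 0 ≤ fun j => a j * b j := fun j => mul_nonneg (ha0 j) (hb0 j)
  exact ⟨summable_of_sum_le hnn key, Real.tsum_le_of_sum_le hnn key⟩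

/-- **Fibrewise-dominated product families.**  For `c ≥ 0` with `Σ c = C` and `F ≥ 0` with every
fibre `F i` summable and `Σⱼ F i j ≤ M`, the family `(i, j) ↦ c i * F i j` is summable over `ι × ι`
with sum at most `C * M` (`summable_prod_of_nonneg`, `HasSum.prod_fiberwise`). [folklore] -/
theorem summable_prod_and_tsum_le {ι : Type*} {c : ι → ℝ} {F : ι → ι → ℝ} {C M : ℝ}
    (hc0 : ∀ i, 0 ≤ c i) (hF0 : ∀ i j, 0 ≤ F i j) (hc : HasSum c C)
    (hF : ∀ i, Summable (F i) ∧ ∑' j, F i j ≤ M) :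
    (Summable fun p : ι × ι => c p.1 * F p.1 p.2) ∧
      ∑' p : ι × ι, c p.1 * F p.1 p.2 ≤ C * M := by
  have hfib : ∀ i, HasSum (fun j => c i * F i j) (c i * ∑' j, F i j) :=
    fun i => (hF i).1.hasSum.mul_left (c i)
  have hle : ∀ i, c i * ∑' j, F i j ≤ c i * M :=
    fun i => mul_le_mul_of_nonneg_left (hF i).2 (hc0 i)
  have hcM : HasSum (fun i => c i * M) (C * M) := hc.mul_right M
  have hsum : Summable fun p : ι × ι => c p.1 * F p.1 p.2 := by
    refine (summable_prod_of_nonneg fun p => mul_nonneg (hc0 p.1) (hF0 p.1 p.2)).2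
      ⟨fun i => (hfib i).summable, ?_⟩
    show Summable fun i => ∑' j, c i * F i j
    refine Summable.of_nonneg_of_le (fun i => ?_) (fun i => ?_) hcM.summable
    · rw [(hfib i).tsum_eq]
      exact mul_nonneg (hc0 i) (tsum_nonneg (hF0 i))
    · rw [(hfib i).tsum_eq]
      exact hle i
  exact ⟨hsum, hasSum_le hle (hsum.hasSum.prod_fiberwise hfib) hcM⟩

/-- **Pointwise domination of the twisted-minus-thermal summand.**  For a sign `s = ±1`,
`0 ≤ l₁`, `0 ≤ l₂ ≤ l₀` and complex `x, y`:
`‖l₂^a l₁^b (s x) y − l₂^a l₁^b x y‖ ≤ 2 l₀^a l₁^b ‖x‖ ‖y‖`. [folklore] -/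
theorem norm_twist_sub_le {s l₁ l₂ l₀ : ℝ} {x y : ℂ} (hs : s = 1 ∨ s = -1) (h₁ : 0 ≤ l₁)
    (h₂ : 0 ≤ l₂) (h₂₀ : l₂ ≤ l₀) (a b : ℕ) :
    ‖(l₂ : ℂ) ^ a * (l₁ : ℂ) ^ b * ((s : ℂ) * x) * y - (l₂ : ℂ) ^ a * (l₁ : ℂ) ^ b * x * y‖ ≤
      2 * l₀ ^ a * l₁ ^ b * (‖x‖ * ‖y‖) := by
  have hfac :
      (l₂ : ℂ) ^ a * (l₁ : ℂ) ^ b * ((s : ℂ) * x) * y - (l₂ : ℂ) ^ a * (l₁ : ℂ) ^ b * x * y =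
        ((s : ℂ) - 1) * ((l₂ : ℂ) ^ a * (l₁ : ℂ) ^ b * x * y) := by ring
  have hs2 : ‖(s : ℂ) - 1‖ ≤ 2 := by
    rw [← Complex.ofReal_one, ← Complex.ofReal_sub, Complex.norm_real, Real.norm_eq_abs]
    rcases hs with rfl | rfl <;> norm_num
  have hrest : ‖(l₂ : ℂ) ^ a * (l₁ : ℂ) ^ b * x * y‖ ≤ l₀ ^ a * l₁ ^ b * (‖x‖ * ‖y‖) := by
    rw [norm_mul, norm_mul, norm_mul, norm_pow, norm_pow, Complex.norm_of_nonneg h₁,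
      Complex.norm_of_nonneg h₂]
    have hpow : l₂ ^ a ≤ l₀ ^ a := pow_le_pow_left₀ h₂ h₂₀ a
    have hnn : 0 ≤ l₁ ^ b * (‖x‖ * ‖y‖) := by positivity
    calc l₂ ^ a * l₁ ^ b * ‖x‖ * ‖y‖ = l₂ ^ a * (l₁ ^ b * (‖x‖ * ‖y‖)) := by ring
      _ ≤ l₀ ^ a * (l₁ ^ b * (‖x‖ * ‖y‖)) := mul_le_mul_of_nonneg_right hpow hnn
      _ = l₀ ^ a * l₁ ^ b * (‖x‖ * ‖y‖) := by ring
  rw [hfac, norm_mul]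
  calc ‖(s : ℂ) - 1‖ * ‖(l₂ : ℂ) ^ a * (l₁ : ℂ) ^ b * x * y‖
        ≤ 2 * (l₀ ^ a * l₁ ^ b * (‖x‖ * ‖y‖)) :=
          mul_le_mul hs2 hrest (norm_nonneg _) (by norm_num)
    _ = 2 * l₀ ^ a * l₁ ^ b * (‖x‖ * ‖y‖) := by ring

end StubNumeratorComparison

open StubNumeratorComparison in
/-- **Twisted double-trace return estimate** (step E3 of line `twisted_trace_transfer`): for
non-negative weights `lam i ≤ lam i₀`, signs `σ i = ±1` with `σ i₀ = 1`, matrix entries `X`,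
`X'` with square-summable rows/columns of `ℓ²`-norm at most `BX`, `BX'`, `Σ lam i ^ β = T`, and
the unconditional double sums `Sth = Σ λ_{p.2}^α λ_{p.1}^β X X'` and
`Stw = Σ λ_{p.2}^α λ_{p.1}^β (σ_{p.1} X) X'` over `ι × ι`, one has
`‖Stw - Sth‖ ≤ 2 BX BX' (lam i₀)^α (T - (lam i₀)^β)`. [folklore] -/
theorem stub_numerator_comparison : ∀ (ι : Type) [Countable ι] (lam σ : ι → ℝ) (i₀ : ι) (α β : ℕ) (X X' : ι → ι → ℂ)
    (BX BX' T : ℝ) (Sth Stw : ℂ),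
    (∀ i, 0 ≤ lam i ∧ lam i ≤ lam i₀) → (∀ i, σ i = 1 ∨ σ i = -1) → σ i₀ = 1 → 0 ≤ BX → 0 ≤ BX' →
    (∀ i, Summable (fun j => ‖X i j‖ ^ 2) ∧ ∑' j, ‖X i j‖ ^ 2 ≤ BX ^ 2) →
    (∀ i, Summable (fun j => ‖X' j i‖ ^ 2) ∧ ∑' j, ‖X' j i‖ ^ 2 ≤ BX' ^ 2) →
    HasSum (fun i => lam i ^ β) T →
    HasSum (fun p : ι × ι => (lam p.2 : ℂ) ^ α * (lam p.1 : ℂ) ^ β * X p.1 p.2 * X' p.2 p.1) Sth →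
    HasSum (fun p : ι × ι => (lam p.2 : ℂ) ^ α * (lam p.1 : ℂ) ^ β * ((σ p.1 : ℂ) * X p.1 p.2) * X' p.2 p.1) Stw →
    ‖Stw - Sth‖ ≤ 2 * BX * BX' * lam i₀ ^ α * (T - lam i₀ ^ β) := by
  intro ι _ lam σ i₀ α β X X' BX BX' T Sth Stw hlam hσ hσ₀ hBX hBX' hX hX' hT hSth hStw
  classical
  -- the weights `i ↦ (0 if i = i₀ else lam i ^ β)` sum to `T - lam i₀ ^ β`
  have hw := hasSum_ite_sub_hasSum hT i₀
  have hl₀ : 0 ≤ lam i₀ := (hlam i₀).1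
  -- the coefficients `c i := 2 * lam i₀ ^ α * w i`
  have hc : HasSum (fun i => 2 * lam i₀ ^ α * (if i = i₀ then 0 else lam i ^ β))
      (2 * lam i₀ ^ α * (T - lam i₀ ^ β)) := hw.mul_left _
  have hc0 : ∀ i, 0 ≤ 2 * lam i₀ ^ α * (if i = i₀ then 0 else lam i ^ β) := by
    intro i
    split_ifs
    · simp
    · have := (hlam i).1
      positivity
  -- fibrewise Cauchy–Schwarz: `Σⱼ ‖X i j‖ ‖X' j i‖ ≤ BX BX'`
  have hCS : ∀ i, (Summable fun j => ‖X i j‖ * ‖X' j i‖) ∧ ∑' j, ‖X i j‖ * ‖X' j i‖ ≤ BX * BX' :=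
    fun i => summable_mul_and_tsum_le (fun j => norm_nonneg _) (fun j => norm_nonneg _) hBX hBX'
      (hX i).1 (hX i).2 (hX' i).1 (hX' i).2
  -- the dominating family is summable with the right sum
  obtain ⟨hgs, hgle⟩ := summable_prod_and_tsum_le
    (c := fun i => 2 * lam i₀ ^ α * (if i = i₀ then 0 else lam i ^ β))
    (F := fun i j => ‖X i j‖ * ‖X' j i‖) hc0 (fun i j => mul_nonneg (norm_nonneg _) (norm_nonneg _))
    hc hCS
  -- compare termwise
  have hdiff := hStw.sub hSth
  refine ((hdiff.norm_le_of_bounded hgs.hasSum fun p => ?_).trans hgle).trans_eq (by ring)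
  obtain ⟨i, j⟩ := p
  dsimp only
  by_cases hi : i = i₀
  · simp [hi, hσ₀]
  · rw [if_neg hi]
    exact norm_twist_sub_le (hσ i) (hlam i).1 (hlam j).1 (hlam j).2 α β

end Summit.QuantumFields.QCD.Cruxes.StableActionBridge.TwistedTraceTransfer
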